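import Summits.QuantumFields.YangMills.Theorems.SwapVirialDeficitBlowUpRingChart
import Summits.QuantumFields.YangMills.Theorems.SwapVirialDeficitBlowUpLeaderChart
import Summits.QuantumFields.YangMills.Theorems.SwapVirialDeficitBlowUpFollowerChart
import HarnessLib

/-!
# THE SCALING IDENTITY (S) of the joint blow-up (brick J3b of memo-24197-massive-mode-rung):
# `μ_L{F^S_z ≤ r·u} = ofReal(coneConst^{6L⁴} · u^{9L⁴−1}) · β(E r u)` — EXACTLY
# (free-hands support of ⟨stmt-QuantumFields-24197⟩ `SwapVirialDeficit.SwapGluedStiffness`; hypothesis (hS) of ✓`BlowUp.smallBall_limit_real_of_blowUp_of_weight`)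

Composition of the three charts: the ring chart ✓`BlowUpRing.ringMeasure_swapDeficit_le_eq_lintegral` (`μ_L{F^S_z ≤ s} = ∫ Haar^{Fol}{U | chartDeficit (C,U) ≤ s} dHaar⁴(C)`),
the leader chart ✓`BlowUp.lintegral_haar_four_eq_leaderChart` (outer integral; its class-function hypothesis is ✓`BlowUpRing.pi_chartDeficit_le_conj`) and the
follower chart ✓`BlowUp.lintegral_haar_pi_eq_followerChart` (inner mass, centres `≡ 1` because the followers of ✓`ringConfig` are RELATIVE coordinates):

* `blowUpPoint t x` — the chart point `(leaderTuple a (dil3 t w), i ↦ quatToSU2 (dilateIm t (y i)))` of a blow-up point `x = (a, (w, y))`,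
  `blowUpSet z χ t s` — the event `dil3 t w ∈ ball3 ∧ (∀ i, ‖dilateIm t (y i)‖ < 1) ∧ chartDeficit L z χ (blowUpPoint t x) ≤ s`; measurability;
* ★ `pi_chartDeficit_le_eq_followerChart` — the inner mass through the follower chart: `Haar^{Fol}{U | chartDeficit (C, U) ≤ s} =
  ofReal(coneConst^{6L⁴−3}·t^{3(6L⁴−3)}) · vol^{Fol}{y | (∀ i, ‖dilateIm t (y i)‖ < 1) ∧ chartDeficit (C, Q ∘ dilateIm t ∘ y) ≤ s}`;
* ★★★ `ringMeasure_swapDeficit_le_eq_blowUp` — for central `χ`, every `t > 0` and every level `s`: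
  `μ_L{F^S_z ≤ s} = ofReal(coneConst^{6L⁴} · t^{18L⁴−2}) · (cone ⊗ (vol³ ⊗ vol^{Fol}))(blowUpSet z χ t s)`;
* ★★★ `ringMeasure_swapDeficit_le_eq_scaling` ∕ `ringMeasure_swapDeficit_le_eq_scaling_rpow` — `t = √u`, `s = r·u`: the hypothesis (hS) of the shell with
  `κ = coneConst^{6L⁴}`, `α = 9L⁴ − 1`, `β = cone ⊗ (vol³ ⊗ vol^{Fol})`, `E r u = blowUpSet z χ (√u) (r·u)` — verbatim.

HONEST LABEL: the EXACT Jacobian bookkeeping of the joint blow-up (plan-level plumbing of a DRAFT line); the dominator (D′), the pointwise blow-up (P) and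
the assembly J6 are NOT here; NOT ⟨24197⟩ ∕ ⟨24194⟩ ∕ ⟨24497⟩; no crux, rung or summit is proved; the Yang–Mills mass gap is NOT proved; no summit is proved
by a line.  Two `def`s (`blowUpPoint`, `blowUpSet`), theorems otherwise; 0 `sorry`; standard axioms; the series' local `ℍ` instances.  Width seat
ym-line-sfw-p2-w2 g57 (cell ym-idea-1, free hands), `--supports stmt-QuantumFields-24197`.  References: [cite: tHooft1979]; [cite: Luscher1983, §2]; [folklore].
-/

set_option autoImplicit false

noncomputable section

open MeasureTheory Quaternion Set
open scoped Quaternion ENNReal BigOperators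
open Literature.MathematicalPhysics.QuantumLattice
open Literature.MathematicalPhysics.QuantumFieldTheory hiding SU2
open Summit.QuantumFields.YangMills.Theorems.SwapTwistDeficit.ToronLog

attribute [local instance] Literature.Analysis.FluidPDE.Tao2016.quatMeasurableSpace
  Literature.Analysis.FluidPDE.Tao2016.quatBorelSpace
  Literature.MathematicalPhysics.QuantumLattice.secondCountableTopology_su2

namespace Summit.QuantumFields.YangMills.Theorems.SwapVirialDeficit.BlowUpRing

open Summit.QuantumFields.YangMills.Theorems.FemtoTransferGap
open Summit.QuantumFields.YangMills.Theorems.FemtoTransferGap.TT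
open Summit.QuantumFields.YangMills.Theorems.VirialFluxGap.RingDeficit
open Summit.QuantumFields.YangMills.Theorems.SwapVirialDeficit.SwapRing
open Summit.QuantumFields.YangMills.Theorems.SwapVirialDeficit.ZeroModeSigma (dil3 measurable_dil3 ball3 measurableSet_ball3 dilateIm continuous_dilateIm)
open Summit.QuantumFields.YangMills.Theorems.SwapVirialDeficit.BlowUp (leaderTuple measurable_leaderTuple lintegral_haar_four_eq_leaderChart
  lintegral_haar_pi_eq_followerChart)

variable {L : ℕ} [NeZero L]

/-! ## §1 The blow-up point and the blow-up event -/

/-- **The chart point of a blow-up point** `x = (a, (w, y))` at scale `t`: leaders `leaderTuple a (dil3 t w)` (✓`BlowUp.leaderTuple`: `(Q x', Q(p·z'), Q y', Q A)`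
with `((x', y'), z') = dil3 t w`), followers `U_i = quatToSU2 (dilateIm t (y i))` (centres `1`: the followers of ✓`ringConfig` are relative coordinates). [folklore] -/
def blowUpPoint (t : ℝ) (x : ℍ × (((ℍ × ℍ) × ℍ) × (Fol L → ℍ))) : (Fin 4 → SU2) × (Fol L → SU2) :=
  (leaderTuple x.1 (dil3 t x.2.1), fun i => quatToSU2 (dilateIm t (x.2.2 i)))

variable (L) in
/-- **The blow-up event** `E(t, s)`: the dilated letters lie in the cone-model balls and the σ-glued deficit of the rebuilt ring history is `≤ s`. [folklore] -/
def blowUpSet (z : Fin 3 → Bool) (χ : Site 3 L → SU2) (t s : ℝ) : Set (ℍ × (((ℍ × ℍ) × ℍ) × (Fol L → ℍ))) :=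
  {x | dil3 t x.2.1 ∈ ball3 ∧ (∀ i, ‖dilateIm t (x.2.2 i)‖ < 1) ∧ chartDeficit L z χ (blowUpPoint t x) ≤ s}

omit [NeZero L] in
/-- `blowUpPoint t` is measurable. [folklore] -/
theorem measurable_blowUpPoint (t : ℝ) : Measurable (blowUpPoint (L := L) t) := by
  refine Measurable.prodMk ?_ ?_
  · exact measurable_leaderTuple.comp (measurable_fst.prodMk ((measurable_dil3 t).comp (measurable_fst.comp measurable_snd)))
  · exact measurable_pi_lambda _ fun i =>
      measurable_quatToSU2.comp ((continuous_dilateIm t).measurable.comp ((measurable_pi_apply i).comp (measurable_snd.comp measurable_snd)))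

/-- The follower ball condition is measurable. [folklore] -/
theorem measurableSet_followerBalls (t : ℝ) : MeasurableSet {y : Fol L → ℍ | ∀ i, ‖dilateIm t (y i)‖ < 1} := by
  have e : {y : Fol L → ℍ | ∀ i, ‖dilateIm t (y i)‖ < 1} = ⋂ i, {y | ‖dilateIm t (y i)‖ < 1} := by
    ext y; simp only [Set.mem_setOf_eq, Set.mem_iInter]
  rw [e]
  exact MeasurableSet.iInter fun i =>
    measurableSet_lt ((continuous_dilateIm t).measurable.comp (measurable_pi_apply i)).norm measurable_const

/-- `blowUpSet` is measurable. [folklore] -/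
theorem measurableSet_blowUpSet (z : Fin 3 → Bool) (χ : Site 3 L → SU2) (t s : ℝ) : MeasurableSet (blowUpSet L z χ t s) := by
  have h1 : MeasurableSet {x : ℍ × (((ℍ × ℍ) × ℍ) × (Fol L → ℍ)) | dil3 t x.2.1 ∈ ball3} :=
    measurableSet_ball3.preimage ((measurable_dil3 t).comp (measurable_fst.comp measurable_snd))
  have h2 : MeasurableSet {x : ℍ × (((ℍ × ℍ) × ℍ) × (Fol L → ℍ)) | ∀ i, ‖dilateIm t (x.2.2 i)‖ < 1} :=
    (measurableSet_followerBalls (L := L) t).preimage (measurable_snd.comp measurable_snd)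
  have h3 : MeasurableSet {x : ℍ × (((ℍ × ℍ) × ℍ) × (Fol L → ℍ)) | chartDeficit L z χ (blowUpPoint t x) ≤ s} :=
    measurableSet_le ((measurable_chartDeficit z χ).comp (measurable_blowUpPoint t)) measurable_const
  exact (h1.inter (h2.inter h3)).congr (by ext x; simp only [blowUpSet, Set.mem_inter_iff, Set.mem_setOf_eq])

/-! ## §2 The inner mass through the follower chart -/

/-- ★ **THE INNER MASS THROUGH THE FOLLOWER CHART** (centres `≡ 1`): for every `t > 0`,
`Haar^{Fol}{U | chartDeficit (C, U) ≤ s} = ofReal(coneConst^{6L⁴−3} · t^{3(6L⁴−3)}) · vol^{Fol}{y | (∀ i, ‖dilateIm t (y i)‖ < 1) ∧ chartDeficit (C, Q ∘ D_t ∘ y) ≤ s}`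
(✓`lintegral_haar_pi_eq_followerChart` on the indicator, ✓`card_fol`). [folklore] -/
theorem pi_chartDeficit_le_eq_followerChart (z : Fin 3 → Bool) (χ : Site 3 L → SU2) (C : Fin 4 → SU2) (s : ℝ) {t : ℝ} (ht : 0 < t) :
    (Measure.pi fun _ : Fol L => haarProbability SU2) {U | chartDeficit L z χ (C, U) ≤ s} =
      ENNReal.ofReal (coneConst ^ (6 * L ^ 4 - 3) * t ^ (3 * (6 * L ^ 4 - 3))) *
        (Measure.pi fun _ : Fol L => (volume : Measure ℍ))
          {y | (∀ i, ‖dilateIm t (y i)‖ < 1) ∧ chartDeficit L z χ (C, fun i => quatToSU2 (dilateIm t (y i))) ≤ s} := by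
  have hT : MeasurableSet {U : Fol L → SU2 | chartDeficit L z χ (C, U) ≤ s} :=
    measurableSet_le ((measurable_chartDeficit z χ).comp (measurable_const.prodMk measurable_id)) measurable_const
  have hY : MeasurableSet {y : Fol L → ℍ | (∀ i, ‖dilateIm t (y i)‖ < 1) ∧ chartDeficit L z χ (C, fun i => quatToSU2 (dilateIm t (y i))) ≤ s} := by
    refine (measurableSet_followerBalls (L := L) t).inter ?_
    exact measurableSet_le ((measurable_chartDeficit z χ).comp (measurable_const.prodMk
      (measurable_pi_lambda _ fun i => measurable_quatToSU2.comp ((continuous_dilateIm t).measurable.comp (measurable_pi_apply i)))))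
      measurable_const
  rw [← lintegral_indicator_one hT, ← lintegral_indicator_one hY,
    lintegral_haar_pi_eq_followerChart (fun _ : Fol L => (1 : ℍ)) (fun _ => norm_one) _ (measurable_one.indicator hT) ht, card_fol]
  congr 1
  refine lintegral_congr fun y => ?_
  simp only [one_mul]
  by_cases h1 : ∀ i, ‖dilateIm t (y i)‖ < 1
  · rw [Set.indicator_of_mem (s := {y : Fol L → ℍ | ∀ i, ‖dilateIm t (y i)‖ < 1}) h1]
    by_cases h2 : chartDeficit L z χ (C, fun i => quatToSU2 (dilateIm t (y i))) ≤ s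
    · rw [Set.indicator_of_mem (s := {U : Fol L → SU2 | chartDeficit L z χ (C, U) ≤ s}) h2,
        Set.indicator_of_mem (s := {y : Fol L → ℍ | (∀ i, ‖dilateIm t (y i)‖ < 1) ∧
          chartDeficit L z χ (C, fun i => quatToSU2 (dilateIm t (y i))) ≤ s}) ⟨h1, h2⟩]
      rfl
    · rw [Set.indicator_of_notMem (s := {U : Fol L → SU2 | chartDeficit L z χ (C, U) ≤ s}) h2,
        Set.indicator_of_notMem (s := {y : Fol L → ℍ | (∀ i, ‖dilateIm t (y i)‖ < 1) ∧
          chartDeficit L z χ (C, fun i => quatToSU2 (dilateIm t (y i))) ≤ s}) (fun h => h2 h.2)]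
  · rw [Set.indicator_of_notMem (s := {y : Fol L → ℍ | ∀ i, ‖dilateIm t (y i)‖ < 1}) h1,
      Set.indicator_of_notMem (s := {y : Fol L → ℍ | (∀ i, ‖dilateIm t (y i)‖ < 1) ∧
        chartDeficit L z χ (C, fun i => quatToSU2 (dilateIm t (y i))) ≤ s}) (fun h => h1 h.1)]

/-! ## §3 The scaling identity -/

/-- The three charts' Jacobian exponents add up: `3 + (6L⁴ − 3) = 6L⁴` and `7 + 3(6L⁴ − 3) = 18L⁴ − 2`. [folklore] -/
theorem jacobian_exponents : 3 + (6 * L ^ 4 - 3) = 6 * L ^ 4 ∧ 7 + 3 * (6 * L ^ 4 - 3) = 18 * L ^ 4 - 2 := by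
  have h4 : 1 ≤ L ^ 4 := Nat.one_le_pow _ _ (Nat.pos_of_ne_zero (NeZero.ne L))
  omega

/-- ★★★ **THE SUBLEVEL VOLUMES OF THE σ-GLUED DEFICIT ON THE BLOW-UP SPACE, EXACTLY**: for central `χ`, every scale `t > 0` and every level `s`,
`μ_L{F^S_z ≤ s} = ofReal(coneConst^{6L⁴} · t^{18L⁴−2}) · (cone ⊗ (vol³ ⊗ vol^{Fol}))(blowUpSet z χ t s)` — ring chart, then leader chart (outer Haar⁴), then
follower chart (inner Haar^{Fol}), then Tonelli. [cite: tHooft1979] [cite: Luscher1983, §2] -/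
theorem ringMeasure_swapDeficit_le_eq_blowUp (z : Fin 3 → Bool) {χ : Site 3 L → SU2} (hχ : ∀ (x : Site 3 L) (k : SU2), k * χ x = χ x * k)
    {t : ℝ} (ht : 0 < t) (s : ℝ) :
    (ringMeasure L) {P | swapRingDeficit L z P ≤ s} =
      ENNReal.ofReal (coneConst ^ (6 * L ^ 4) * t ^ (18 * L ^ 4 - 2)) *
        (coneMeasure.prod ((volume : Measure ((ℍ × ℍ) × ℍ)).prod (Measure.pi fun _ : Fol L => (volume : Measure ℍ))))
          (blowUpSet L z χ t s) := by
  haveI := isProbabilityMeasure_coneMeasure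
  set vF : Measure (Fol L → ℍ) := Measure.pi fun _ : Fol L => (volume : Measure ℍ) with hvF
  haveI : SigmaFinite vF := by rw [hvF]; infer_instance
  set B : ℝ := coneConst ^ (6 * L ^ 4 - 3) * t ^ (3 * (6 * L ^ 4 - 3)) with hB
  have hE := measurableSet_blowUpSet z χ t s
  -- (1) ring chart + leader chart
  rw [ringMeasure_swapDeficit_le_eq_lintegral z χ s,
    lintegral_haar_four_eq_leaderChart _ (measurable_pi_chartDeficit_le z χ s) (fun h C => pi_chartDeficit_le_conj z hχ h C s) ht]
  -- (2) follower chart inside, and the section of the blow-up event over `(a, w)`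
  have hsec : ∀ (a : ℍ) (w : (ℍ × ℍ) × ℍ),
      ball3.indicator (fun w' => (Measure.pi fun _ : Fol L => haarProbability SU2) {U | chartDeficit L z χ (leaderTuple a w', U) ≤ s}) (dil3 t w) =
        ENNReal.ofReal B * vF (Prod.mk w ⁻¹' (Prod.mk a ⁻¹' blowUpSet L z χ t s)) := by
    intro a w
    by_cases hb : dil3 t w ∈ ball3
    · rw [Set.indicator_of_mem hb, pi_chartDeficit_le_eq_followerChart z χ _ s ht]
      congr 2
      ext y
      simp only [blowUpSet, blowUpPoint, Set.mem_setOf_eq, Set.mem_preimage, hb, true_and]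
    · rw [Set.indicator_of_notMem hb]
      have he : Prod.mk w ⁻¹' (Prod.mk a ⁻¹' blowUpSet L z χ t s) = ∅ := by
        ext y
        simp only [blowUpSet, Set.mem_preimage, Set.mem_setOf_eq, hb, false_and, Set.mem_empty_iff_false]
      rw [he, measure_empty, mul_zero]
  simp_rw [hsec]
  -- (3) Tonelli on `β = cone ⊗ (vol³ ⊗ vol^{Fol})`
  have hβ : (coneMeasure.prod ((volume : Measure ((ℍ × ℍ) × ℍ)).prod vF)) (blowUpSet L z χ t s) =
      ∫⁻ a, ∫⁻ w, vF (Prod.mk w ⁻¹' (Prod.mk a ⁻¹' blowUpSet L z χ t s)) ∂(volume : Measure ((ℍ × ℍ) × ℍ)) ∂coneMeasure := by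
    rw [Measure.prod_apply hE]
    refine lintegral_congr fun a => ?_
    rw [Measure.prod_apply (measurable_prodMk_left hE)]
  rw [hβ]
  have hBtop : ENNReal.ofReal B ≠ ∞ := ENNReal.ofReal_ne_top
  simp_rw [lintegral_const_mul' _ _ hBtop]
  rw [← mul_assoc]
  congr 1
  have hc0 : 0 ≤ coneConst := by rw [coneConst]; exact ENNReal.toReal_nonneg
  rw [← ENNReal.ofReal_mul (by positivity), hB]
  congr 1
  obtain ⟨h1, h2⟩ := jacobian_exponents (L := L)
  calc coneConst ^ 3 * t ^ 7 * (coneConst ^ (6 * L ^ 4 - 3) * t ^ (3 * (6 * L ^ 4 - 3)))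
      = coneConst ^ (3 + (6 * L ^ 4 - 3)) * t ^ (7 + 3 * (6 * L ^ 4 - 3)) := by rw [pow_add, pow_add]; ring
    _ = coneConst ^ (6 * L ^ 4) * t ^ (18 * L ^ 4 - 2) := by rw [h1, h2]

/-- ★★★ **THE SCALING IDENTITY (S)**: for central `χ`, any `r` and every `u > 0`,
`μ_L{F^S_z ≤ r·u} = ofReal(coneConst^{6L⁴} · u^{9L⁴−1}) · (cone ⊗ (vol³ ⊗ vol^{Fol}))(blowUpSet z χ (√u) (r·u))` (`t = √u`, `(√u)^{18L⁴−2} = u^{9L⁴−1}`) —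
the exact Jacobian `κ·u^α`, `κ = coneConst^{6L⁴}`, `α = 9L⁴ − 1`, of the joint blow-up. [cite: tHooft1979] [cite: Luscher1983, §2] -/
theorem ringMeasure_swapDeficit_le_eq_scaling (z : Fin 3 → Bool) {χ : Site 3 L → SU2} (hχ : ∀ (x : Site 3 L) (k : SU2), k * χ x = χ x * k)
    (r : ℝ) {u : ℝ} (hu : 0 < u) :
    (ringMeasure L) {P | swapRingDeficit L z P ≤ r * u} =
      ENNReal.ofReal (coneConst ^ (6 * L ^ 4) * u ^ (9 * L ^ 4 - 1)) *
        (coneMeasure.prod ((volume : Measure ((ℍ × ℍ) × ℍ)).prod (Measure.pi fun _ : Fol L => (volume : Measure ℍ))))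
          (blowUpSet L z χ (Real.sqrt u) (r * u)) := by
  rw [ringMeasure_swapDeficit_le_eq_blowUp z hχ (Real.sqrt_pos.2 hu) (r * u)]
  have h4 : 1 ≤ L ^ 4 := Nat.one_le_pow _ _ (Nat.pos_of_ne_zero (NeZero.ne L))
  have he : 18 * L ^ 4 - 2 = 2 * (9 * L ^ 4 - 1) := by omega
  rw [he, pow_mul (Real.sqrt u), Real.sq_sqrt hu.le]

/-- ★★★ **(S) in the shape of hypothesis (hS) of ✓`BlowUp.smallBall_limit_real_of_blowUp_of_weight`** (real exponent `α = ((9L⁴ − 1 : ℕ) : ℝ)`):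
`μ_L{F^S_z ≤ r·u} = ofReal(κ · u^α) · β(E r u)` with `κ = coneConst^{6L⁴}`, `β = cone ⊗ (vol³ ⊗ vol^{Fol})`, `E r u = blowUpSet z χ (√u) (r·u)`. [cite: tHooft1979]
[cite: Luscher1983, §2] -/
theorem ringMeasure_swapDeficit_le_eq_scaling_rpow (z : Fin 3 → Bool) {χ : Site 3 L → SU2} (hχ : ∀ (x : Site 3 L) (k : SU2), k * χ x = χ x * k)
    (r u : ℝ) (hu : 0 < u) :
    (ringMeasure L) {P | swapRingDeficit L z P ≤ r * u} =
      ENNReal.ofReal (coneConst ^ (6 * L ^ 4) * u ^ (((9 * L ^ 4 - 1 : ℕ) : ℝ))) *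
        (coneMeasure.prod ((volume : Measure ((ℍ × ℍ) × ℍ)).prod (Measure.pi fun _ : Fol L => (volume : Measure ℍ))))
          (blowUpSet L z χ (Real.sqrt u) (r * u)) := by
  rw [Real.rpow_natCast]
  exact ringMeasure_swapDeficit_le_eq_scaling z hχ r hu

/-- `κ = coneConst^{6L⁴} ≥ 0` (hypothesis (hκ) of the shell). [folklore] -/
theorem coneConst_pow_nonneg (n : ℕ) : 0 ≤ coneConst ^ n := by
  have hc0 : 0 ≤ coneConst := by rw [coneConst]; exact ENNReal.toReal_nonneg
  exact pow_nonneg hc0 n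

end Summit.QuantumFields.YangMills.Theorems.SwapVirialDeficit.BlowUpRing

end
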